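import Mathlib
import Literature.Computability.AlgebraicComplexity.ArithCircuitProofs
import Literature.Computability.AlgebraicComplexity.IMMInVPProofs
import Literature.Computability.AlgebraicComplexity.RazUniversalCircuits
import HarnessLib

/-!
# Crux `BarrierLever.SuccinctHittingSetsForVP` (stmt-ValiantsHypothesis-14610), line `registered` —
THE OUTPUT OF RAZ'S UNIVERSAL CIRCUIT-GRAPH IS A SMALL CIRCUIT (size and homogeneity of `OUT(y)`)

The tree's `RazUniversal` (Raz 2010, Prop. 2.8 / 3.3) provides the universal layered
circuit-graph through its node polynomials `baseVal y d b` and output `outVal y`, and proves that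
every homogeneous degree-`r` polynomial of complexity `≤ s` IS an output (`exists_labels_of_complexity_le`).
For the converse direction of FSV's reformulation of Question 6 (every output is again a small
circuit, so the universal circuit is a polynomially invertible GENERATOR of the simple class) one
needs the two facts proved here, over `ℂ`:

* `complexity_outVal_le` (registered stub `stub_universalOutputComplexity` for `σ = Fin n`):
  `L(OUT(y)) ≤ 2B + r · (rN) · (4B + 1)` with `B = #σ + rN` the number of nodes per level — the
  graph has `r` levels of `rN` product slots, each the product of two `y`-weighted sums of the `B`
  nodes below. SHARING is obtained without multi-output circuits by substituting level by level
  from the TOP: the output as a polynomial `U_i` in node SYMBOLS of levels `≤ r - i` satisfies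
  `U_{i+1} = U_i[level (r-i) symbols ↦ their defining quadratic expressions]`, so the substitution
  bound `L(f(g)) ≤ L(f) + Σ L(g_z)` (`complexity_aeval_le`, Bürgisser 2000 Rem. 2.7) charges every
  slot ONCE; after `r` steps only input symbols remain (`vars` bookkeeping,
  `exists_rename_eq_of_vars_subset_range`) and `U_r` is `OUT(y)` itself.
* `isHomogeneous_outVal` : `OUT(y)` is homogeneous of degree `r` (level `d` nodes are homogeneous
  of degree `d`, by strong induction on `d` through `baseVal_inl` / `baseVal_inr`).

References: [Raz2010] Prop. 2.8 (pp. 154–155), §3.2; [Burgisser2000] Rem. 2.7 (substitution).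
Axioms: `propext`, `Classical.choice`, `Quot.sound`.
-/

-- layout Summits/ValiantsHypothesis/ValiantsHypothesis forces the duplicated namespace component
set_option linter.dupNamespace false

namespace Summit.ValiantsHypothesis.ValiantsHypothesis.Theorems.BarrierLever.SuccinctHittingSetsForVP

open Literature.Computability.AlgebraicComplexity MvPolynomial RazUniversal

namespace UniversalSize

variable {σ : Type*} [Fintype σ] {r N : ℕ}

/-! ### Small pieces: weighted sums of symbols -/

/-- A `y`-weighted sum of `B` symbols costs `≤ 2B` gates. [cite: Burgisser2000, §2.1] -/
theorem complexity_weightedSum_le {Z : Type*} {ι : Type*} [Fintype ι] (a : ι → ℂ) (z : ι → Z) :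
    complexity (∑ i, C (a i) * (X (z i) : MvPolynomial Z ℂ)) ≤ 2 * Fintype.card ι := by
  calc complexity (∑ i, C (a i) * (X (z i) : MvPolynomial Z ℂ))
      ≤ ∑ i, complexity (C (a i) * (X (z i) : MvPolynomial Z ℂ)) + (Finset.univ : Finset ι).card :=
        complexity_finset_sum_le _ _
    _ ≤ ∑ _i : ι, 1 + (Finset.univ : Finset ι).card := by
        gcongr with i
        calc complexity (C (a i) * (X (z i) : MvPolynomial Z ℂ))
            ≤ complexity (C (a i) : MvPolynomial Z ℂ) + complexity (X (z i) : MvPolynomial Z ℂ) + 1 :=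
              complexity_mul_le_holds _ _
          _ = 1 := by rw [complexity_C_holds, complexity_X_holds]
    _ = 2 * Fintype.card ι := by simp [two_mul]

/-- Its variables are among the symbols summed over. [folklore] -/
theorem vars_weightedSum_subset {Z : Type*} [DecidableEq Z] {ι : Type*} [Fintype ι] (a : ι → ℂ)
    (z : ι → Z) :
    (∑ i, C (a i) * (X (z i) : MvPolynomial Z ℂ)).vars ⊆ Finset.univ.image z := by
  intro v hv
  have h := vars_sum_subset (t := Finset.univ) (φ := fun i => C (a i) * (X (z i) : MvPolynomial Z ℂ)) hv
  simp only [Finset.mem_biUnion, Finset.mem_univ, true_and] at h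
  obtain ⟨i, hi⟩ := h
  have h2 := vars_mul _ _ hi
  rw [vars_C, Finset.empty_union, vars_X, Finset.mem_singleton] at h2
  exact Finset.mem_image.mpr ⟨i, Finset.mem_univ _, h2.symm⟩

/-- Evaluating a weighted sum of symbols. [folklore] -/
theorem aeval_weightedSum {Z : Type*} {ι : Type*} [Fintype ι] {A : Type*} [CommSemiring A]
    [Algebra ℂ A] (V : Z → A) (a : ι → ℂ) (z : ι → Z) :
    aeval V (∑ i, C (a i) * (X (z i) : MvPolynomial Z ℂ)) = ∑ i, a i • V (z i) := by
  simp [map_sum, Algebra.smul_def]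

/-! ### Homogeneity of the universal circuit-graph -/

/-- Level-`d` nodes compute homogeneous polynomials of degree `d`. [cite: Raz2010, Prop. 2.8 (p. 154)] -/
theorem isHomogeneous_baseVal (y : Lab σ r N → ℂ) :
    ∀ (n : ℕ) (d : Fin (r + 1)), (d : ℕ) = n → ∀ b, (baseVal y d b).IsHomogeneous n := by
  intro n
  induction n using Nat.strong_induction_on with
  | _ n ih =>
    intro d hd b
    rcases b with t | ⟨j, k⟩
    · rw [baseVal_inl]
      split_ifs with h1
      · rw [← hd, h1]; exact isHomogeneous_X ℂ t
      · exact isHomogeneous_zero σ ℂ n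
    · by_cases h : 1 ≤ (j : ℕ) ∧ (j : ℕ) < (d : ℕ)
      · rw [baseVal_inr y d j k h]
        have h1 : (∑ b, y (Sum.inl (d, j, k, false, b)) • baseVal y (Fin.castSucc j) b).IsHomogeneous
            (j : ℕ) := by
          refine IsHomogeneous.sum _ _ _ fun b _ => ?_
          rw [smul_eq_C_mul]
          exact IsHomogeneous.C_mul (ih j (by omega) (Fin.castSucc j) (by simp) b) _
        have h2 : (∑ b, y (Sum.inl (d, j, k, true, b)) •
            baseVal y ⟨(d : ℕ) - j, by have := d.isLt; omega⟩ b).IsHomogeneous ((d : ℕ) - j) := by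
          refine IsHomogeneous.sum _ _ _ fun b _ => ?_
          rw [smul_eq_C_mul]
          exact IsHomogeneous.C_mul (ih ((d : ℕ) - j) (by omega) ⟨(d : ℕ) - j, _⟩ rfl b) _
        have := IsHomogeneous.mul h1 h2
        rwa [show (j : ℕ) + ((d : ℕ) - j) = n by omega] at this
      · rw [baseVal_inr_of_not y d j k h]
        exact isHomogeneous_zero σ ℂ n

/-- **`OUT(y)` is homogeneous of degree `r`.** [cite: Raz2010, Prop. 2.8 (p. 154)] -/
theorem isHomogeneous_outVal (y : Lab σ r N → ℂ) : (outVal y).IsHomogeneous r := by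
  rw [outVal_eq]
  refine IsHomogeneous.sum _ _ _ fun b _ => ?_
  rw [smul_eq_C_mul]
  exact IsHomogeneous.C_mul (isHomogeneous_baseVal y r (Fin.last r) (by simp) b) _

/-! ### The size of `OUT(y)` -/

/-- **`OUT(y)` is a small circuit**: `L(OUT(y)) ≤ 2B + r · (rN) · (4B + 1)`, `B = #σ + rN`.
[cite: Raz2010, Prop. 2.8 (pp. 154–155); Burgisser2000, Rem. 2.7] -/
theorem complexity_outVal_le (y : Lab σ r N → ℂ) :
    complexity (outVal y) ≤ 2 * (Fintype.card σ + r * N) +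
      r * ((r * N) * (4 * (Fintype.card σ + r * N) + 1)) := by
  classical
  -- the degenerate graph `r = 0` outputs `0`
  rcases Nat.eq_zero_or_pos r with hr0 | hr1
  · subst hr0
    have h0 : outVal y = 0 := by
      rw [outVal_eq]
      refine Finset.sum_eq_zero fun b _ => ?_
      rcases b with t | ⟨j, _⟩
      · rw [baseVal_inl]; simp
      · exact j.elim0
    rw [h0]
    have : complexity (0 : MvPolynomial σ ℂ) = 0 := by simpa using complexity_C_holds (σ := σ) (0 : ℂ)
    omega
  -- node symbols: inputs `inl t` and nodes `inr (d, b)`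
  set B := Fintype.card σ + r * N with hB
  have hcardB : Fintype.card (BIdx σ r N) = B := by
    simp [BIdx, Fintype.card_sum, Fintype.card_prod, Fintype.card_fin, hB]
  set K := (r * N) * (4 * B + 1) with hK
  let Zt := σ ⊕ (Fin (r + 1) × BIdx σ r N)
  -- semantics of the symbols
  let V : Zt → MvPolynomial σ ℂ := Sum.elim X fun p => baseVal y p.1 p.2
  -- defining expression of node `(d, b)` in terms of lower symbols
  let E : Fin (r + 1) → BIdx σ r N → MvPolynomial Zt ℂ := fun d =>
    Sum.elim (fun t => if (d : ℕ) = 1 then X (Sum.inl t) else 0) fun jk =>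
      if h : 1 ≤ (jk.1 : ℕ) ∧ (jk.1 : ℕ) < (d : ℕ) then
        (∑ b, C (y (Sum.inl (d, jk.1, jk.2, false, b))) *
            (X (Sum.inr (Fin.castSucc jk.1, b)) : MvPolynomial Zt ℂ)) *
          (∑ b, C (y (Sum.inl (d, jk.1, jk.2, true, b))) *
            (X (Sum.inr (⟨(d : ℕ) - jk.1, by have := d.isLt; omega⟩, b)) : MvPolynomial Zt ℂ))
      else 0
  -- substitution expanding exactly the symbols of level `d`
  let φ : Fin (r + 1) → Zt → MvPolynomial Zt ℂ := fun d =>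
    Sum.elim (fun t => X (Sum.inl t)) fun p => if p.1 = d then E d p.2 else X (Sum.inr p)
  -- (F1) the defining expressions evaluate to the node polynomials
  have hE : ∀ d b, aeval V (E d b) = baseVal y d b := by
    intro d b
    rcases b with t | ⟨j, k⟩
    · simp only [E, Sum.elim_inl]
      rw [baseVal_inl]
      split_ifs <;> simp [V]
    · simp only [E, Sum.elim_inr]
      by_cases h : 1 ≤ (j : ℕ) ∧ (j : ℕ) < (d : ℕ)
      · rw [dif_pos h, map_mul, aeval_weightedSum, aeval_weightedSum, baseVal_inr y d j k h]
        rfl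
      · rw [dif_neg h, map_zero, baseVal_inr_of_not y d j k h]
  -- (F2) hence `φ d` does not change the semantics
  have hφ : ∀ d z, aeval V (φ d z) = V z := by
    intro d z
    rcases z with t | p
    · simp [φ, V]
    · simp only [φ, Sum.elim_inr]
      split_ifs with hp
      · rw [hE]; simp [V, hp]
      · simp [V]
  have hφ' : ∀ d (T : MvPolynomial Zt ℂ), aeval V (aeval (φ d) T) = aeval V T := by
    intro d T
    rw [← AlgHom.comp_apply, comp_aeval]
    have : (fun i => aeval V (φ d i)) = V := funext (hφ d)
    rw [this]
  -- (F3) cost of one level of substitutions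
  have hcostE : ∀ d b, complexity (E d b) ≤ 4 * B + 1 := by
    intro d b
    rcases b with t | ⟨j, k⟩
    · simp only [E, Sum.elim_inl]
      split_ifs
      · rw [complexity_X_holds]; omega
      · have : complexity (0 : MvPolynomial Zt ℂ) = 0 := by
          simpa using complexity_C_holds (σ := Zt) (0 : ℂ)
        omega
    · simp only [E, Sum.elim_inr]
      split_ifs
      · refine (complexity_mul_le_holds _ _).trans ?_
        have h1 := complexity_weightedSum_le (Z := Zt)
          (fun b => y (Sum.inl (d, j, k, false, b))) (fun b => Sum.inr (Fin.castSucc j, b))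
        have h2 := complexity_weightedSum_le (Z := Zt)
          (fun b => y (Sum.inl (d, j, k, true, b)))
          (fun b => Sum.inr (⟨(d : ℕ) - j, by have := d.isLt; omega⟩, b))
        rw [hcardB] at h1 h2
        omega
      · have : complexity (0 : MvPolynomial Zt ℂ) = 0 := by
          simpa using complexity_C_holds (σ := Zt) (0 : ℂ)
        omega
  have hcostφ : ∀ d, ∑ z, complexity (φ d z) ≤ K := by
    intro d
    rw [hK, Fintype.sum_sum_type]
    have h0 : ∑ t : σ, complexity (φ d (Sum.inl t)) = 0 :=
      Finset.sum_eq_zero fun t _ => by simp only [φ, Sum.elim_inl]; exact complexity_X_holds _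
    rw [h0, zero_add, Fintype.sum_prod_type]
    -- only the row `d' = d` contributes
    rw [Finset.sum_eq_single d]
    · -- the row `d`: leaves cost nothing, slots cost `≤ 4B + 1`
      simp only [φ, Sum.elim_inr, if_true]
      rw [Fintype.sum_sum_type]
      have hl : ∑ t : σ, complexity (E d (Sum.inl t)) = 0 := Finset.sum_eq_zero fun t _ => by
        simp only [E, Sum.elim_inl]
        split_ifs
        · exact complexity_X_holds _
        · simpa using complexity_C_holds (σ := Zt) (0 : ℂ)
      rw [hl, zero_add]
      calc ∑ jk : Fin r × Fin N, complexity (E d (Sum.inr jk))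
          ≤ ∑ _jk : Fin r × Fin N, (4 * B + 1) := Finset.sum_le_sum fun jk _ => hcostE d _
        _ = (r * N) * (4 * B + 1) := by simp [Fintype.card_prod, Fintype.card_fin]
    · intro d' _ hne
      exact Finset.sum_eq_zero fun b _ => by
        simp only [φ, Sum.elim_inr, if_neg hne]; exact complexity_X_holds _
    · intro h; exact absurd (Finset.mem_univ d) h
  -- (F4) the variables after expanding level `d`
  let inS : ℕ → Zt → Prop := fun m => Sum.elim (fun _ => True) fun p => 1 ≤ (p.1 : ℕ) ∧ (p.1 : ℕ) ≤ m
  have hvarsE : ∀ (d : Fin (r + 1)) b, ∀ v ∈ (E d b).vars, inS ((d : ℕ) - 1) v := by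
    intro d b v hv
    rcases b with t | ⟨j, k⟩
    · simp only [E, Sum.elim_inl] at hv
      split_ifs at hv
      · rw [vars_X, Finset.mem_singleton] at hv; subst hv; trivial
      · simp at hv
    · simp only [E, Sum.elim_inr] at hv
      split_ifs at hv with h
      · rcases Finset.mem_union.mp (vars_mul _ _ hv) with h1 | h1
        · obtain ⟨b, -, rfl⟩ := Finset.mem_image.mp (vars_weightedSum_subset _ _ h1)
          simp only [inS, Sum.elim_inr, Fin.val_castSucc]
          omega
        · obtain ⟨b, -, rfl⟩ := Finset.mem_image.mp (vars_weightedSum_subset _ _ h1)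
          simp only [inS, Sum.elim_inr]
          omega
      · simp at hv
  have hvarsφ : ∀ (d : Fin (r + 1)) (T : MvPolynomial Zt ℂ), 1 ≤ (d : ℕ) →
      (∀ v ∈ T.vars, inS d v) → ∀ v ∈ (aeval (φ d) T).vars, inS ((d : ℕ) - 1) v := by
    intro d T hd hT v hv
    rw [aeval_eq_bind₁] at hv
    obtain ⟨z, hz, hvz⟩ := Finset.mem_biUnion.mp (vars_bind₁ _ _ hv)
    have hzS := hT z hz
    rcases z with t | ⟨d', b⟩
    · simp only [φ, Sum.elim_inl] at hvz
      rw [vars_X, Finset.mem_singleton] at hvz; subst hvz; trivial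
    · simp only [φ, Sum.elim_inr] at hvz
      split_ifs at hvz with hp
      · subst hp; exact hvarsE _ _ v hvz
      · rw [vars_X, Finset.mem_singleton] at hvz
        subst hvz
        simp only [inS, Sum.elim_inr] at hzS ⊢
        have : (d' : ℕ) ≠ (d : ℕ) := fun h => hp (Fin.ext h)
        omega
  -- (F5) the top: output gate as a weighted sum of level-`r` symbols
  let top : MvPolynomial Zt ℂ := ∑ b, C (y (Sum.inr b)) * X (Sum.inr (Fin.last r, b))
  have htopV : aeval V top = outVal y := by
    simp only [top]
    rw [aeval_weightedSum, outVal_eq]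
    simp [V]
  have htopC : complexity top ≤ 2 * B := by
    have := complexity_weightedSum_le (Z := Zt) (fun b => y (Sum.inr b))
      (fun b => Sum.inr (Fin.last r, b))
    rwa [hcardB] at this
  have htopS : ∀ v ∈ top.vars, inS r v := by
    intro v hv
    obtain ⟨b, -, rfl⟩ := Finset.mem_image.mp (vars_weightedSum_subset _ _ hv)
    simp only [inS, Sum.elim_inr, Fin.val_last]
    omega
  -- (F6) expand the levels `r, r-1, …, 1`
  let U : ℕ → MvPolynomial Zt ℂ := fun i =>
    Nat.rec top (fun i acc => aeval (φ ⟨r - i, by omega⟩) acc) i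
  have hU0 : U 0 = top := rfl
  have hUs : ∀ i, U (i + 1) = aeval (φ ⟨r - i, by omega⟩) (U i) := fun i => rfl
  have hUV : ∀ i, aeval V (U i) = outVal y := by
    intro i
    induction i with
    | zero => rw [hU0, htopV]
    | succ i ih => rw [hUs, hφ', ih]
  have hUC : ∀ i, complexity (U i) ≤ 2 * B + i * K := by
    intro i
    induction i with
    | zero => rw [hU0]; simpa using htopC
    | succ i ih =>
      rw [hUs, add_mul, one_mul]
      refine (complexity_aeval_le _ _).trans ?_
      have := hcostφ ⟨r - i, by omega⟩
      omega
  have hUvars : ∀ i, i ≤ r → ∀ v ∈ (U i).vars, inS (r - i) v := by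
    intro i
    induction i with
    | zero => intro _ v hv; rw [hU0] at hv; simpa using htopS v hv
    | succ i ih =>
      intro hi v hv
      rw [hUs] at hv
      have h := hvarsφ ⟨r - i, by omega⟩ (U i) (by simp; omega) (ih (by omega)) v hv
      simp only at h
      rwa [show r - i - 1 = r - (i + 1) by omega] at h
  -- (F7) after `r` steps only input symbols remain: `U r = rename inl q`, and `q = OUT(y)`
  have hvars : ↑(U r).vars ⊆ Set.range (Sum.inl : σ → Zt) := by
    intro v hv
    have h := hUvars r le_rfl v hv
    rcases v with t | p
    · exact ⟨t, rfl⟩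
    · simp only [inS, Sum.elim_inr, Nat.sub_self] at h; omega
  obtain ⟨q, hq⟩ := exists_rename_eq_of_vars_subset_range (U r) Sum.inl Sum.inl_injective hvars
  have hqout : q = outVal y := by
    have h1 := hUV r
    rw [← hq, aeval_rename] at h1
    have h2 : (V ∘ Sum.inl : σ → MvPolynomial σ ℂ) = X := by funext t; simp [V]
    rw [h2, aeval_X_left] at h1
    simpa using h1
  calc complexity (outVal y) = complexity q := by rw [hqout]
    _ = complexity (rename (Sum.inl : σ → Zt) q) :=
        (complexity_rename_of_injective_holds Sum.inl_injective q).symm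
    _ = complexity (U r) := by rw [hq]
    _ ≤ 2 * B + r * K := hUC r

/-- Polynomial form for `σ = Fin n`: `L(OUT(y)) ≤ 7 (n + r + N + 1)^5`. [cite: Raz2010, Prop. 2.8] -/
theorem complexity_outVal_le_poly {n : ℕ} (y : Lab (Fin n) r N → ℂ) :
    complexity (outVal y) ≤ 7 * (n + r + N + 1) ^ 5 := by
  refine (complexity_outVal_le y).trans ?_
  rw [Fintype.card_fin]
  set X := n + r + N + 1 with hX
  have h1 : n + r * N ≤ X ^ 2 := by nlinarith
  have h2 : r * N ≤ X ^ 2 := by nlinarith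
  have h3 : r ≤ X := by omega
  have h4 : 4 * (n + r * N) + 1 ≤ 5 * X ^ 2 := by nlinarith
  have hX1 : 1 ≤ X := by omega
  calc 2 * (n + r * N) + r * ((r * N) * (4 * (n + r * N) + 1))
      ≤ 2 * X ^ 2 + X * (X ^ 2 * (5 * X ^ 2)) := by gcongr
    _ = 2 * X ^ 2 + 5 * X ^ 5 := by ring
    _ ≤ 2 * X ^ 5 + 5 * X ^ 5 := by
        have : X ^ 2 ≤ X ^ 5 := Nat.pow_le_pow_right hX1 (by norm_num)
        omega
    _ = 7 * X ^ 5 := by ring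

end UniversalSize

/-- **Registered stub `stub_universalOutputComplexity`** (crux stmt-ValiantsHypothesis-14610, line
`registered`; STRUCTURE of the open stub `stub_levelOne` — the converse half of FSV's
universal-circuit reformulation): every output of Raz's universal circuit-graph on `n` inputs with
`r` levels and `N` slots is a fan-in-two circuit of size `≤ 7 (n + r + N + 1)^5` and a homogeneous
polynomial of degree `r`. [cite: Raz2010, Prop. 2.8 (pp. 154–155)] -/
theorem stub_universalOutputComplexity :
    ∀ (n r N : ℕ) (y : RazUniversal.Lab (Fin n) r N → ℂ),
      complexity (RazUniversal.outVal y) ≤ 7 * (n + r + N + 1) ^ 5 ∧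
        (RazUniversal.outVal y).IsHomogeneous r :=
  fun _ _ _ y => ⟨UniversalSize.complexity_outVal_le_poly y, UniversalSize.isHomogeneous_outVal y⟩

end Summit.ValiantsHypothesis.ValiantsHypothesis.Theorems.BarrierLever.SuccinctHittingSetsForVP
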